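import Mathlib
import HarnessLib
import Summits.Ventures.LatticeQCDFlow.Scoring.DoeblinSkeleton
import Summits.Ventures.LatticeQCDFlow.Scaling.TunnellingLaws

/-!
# FREEZING WITHOUT REVERSIBILITY: if a sampler changes the observable `g` (`|g| ≤ B`) with stationary
# one-step probability at most `p`, then `C_g(t) ≥ Var_π g − 2B² t p` at EVERY lag `t` — the
# autocorrelation of a rarely-changing observable decays at most linearly — and every window
# `τ_W ≥ W + ½ − B² p W(W+1)/Var_π g`

HONEST FRAMING: exact (Metropolis-corrected) sampling algorithms for lattice gauge theory;
figures of merit are autocorrelation/cost numbers at stated couplings and volumes; no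
continuum-physics claim.

Venture `LatticeQCDFlow` (cell pub-lqcd), topic `Scoring`; FANOUT row 8 (`s0-cpn-nemc`, GEN-23).
NEW WORK of the cell, not a published result; no definition is introduced; nothing is cited as a
fact.  The theory pair types a TUNNELLING LAW for the engine's `U(1)` HMC — a bound on the stationary
one-step probability `(π ⊗ₘ K){Q ≠ Q'}` that the topological charge changes
(`StatementSectors.S10_LeapfrogHMCExactAndFrozen`).  THIS FILE turns ANY such bound into
autocorrelation FLOORS for ANY Markov kernel — reversible or not (deterministic-scan sweeps, lifted and
non-reversible updates included) — with elementary means (Fubini for `π ⊗ₘ κ`, a union bound along the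
composition `η ∘ₖ κ`, invariance).  For a Markov kernel `κ`, a probability law `π`, a bounded measurable
`g` (`|g| ≤ B`) and the change set `D = {(x, y) | g x ≠ g y}`:
(1) `⟨g, g − kop κ g⟩_π = ∫∫ g(x)(g(x) − g(y)) κ(x,dy) π(dx) ≤ 2B² · (π ⊗ₘ κ)(D)` (the integrand vanishes
off `D`; NO invariance needed), i.e. `C(1) ≥ ∫ g² dπ − 2B² p`;
(2) UNION BOUND: for `π` `κ`-invariant and any Markov `η`, `(π ⊗ₘ (η ∘ₖ κ))(D) ≤ (π ⊗ₘ κ)(D) + (π ⊗ₘ η)(D)`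
(`{g x ≠ g z} ⊆ {g x ≠ g y} ∪ {g y ≠ g z}`), hence `(π ⊗ₘ κᵗ)(D) ≤ t · (π ⊗ₘ κ)(D)` for the `t`-step
kernel `κᵗ = Exactness.nHit κ t`;
(3) therefore, with `C(t) = ∫ g · (kop κ)^[t] g dπ` (`= autocov κ π g t`; `(kop κ)^[t] = kop κᵗ`,
`Scoring/DoeblinSkeleton.kop_nHit`): **`C(t) ≥ ∫ g² dπ − 2 B² t p` for every `t`** whenever
`(π ⊗ₘ κ)(D) ≤ p`; for centred `g` this reads `ρ_g(t) ≥ 1 − 2B² t p / Var_π g` — the autocorrelation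
cannot decay faster than linearly at slope `2B²p/Var`; and the Γ-method WINDOWS obey
**`τ_W(g) = ½ + Σ_{t≤W} ρ_g(t) ≥ W + ½ − B² p W(W+1)/Var_π g`** (`Scoring.tauIntWindow`), so the
window at `W ≈ Var/(2B²p)` is already of order `Var/(4B²p)`.  Reading for the venture (value-free): a
certified tunnelling bound `p` for the topological charge of ANY exact sampler certifies that the
measured autocorrelation of the charge stays above `1 − 2B²tp/Var` for `t ≲ Var/(2B²p)` — topological
freezing as a theorem on the autocorrelation FUNCTION, reversible or not.  Companions in the tree: the
row's SECTOR-INDICATOR linear law `Scoring/SectorLinearLaw` (`ρ_t(1_A) ≥ 1 − tΦ/(a(1−a))` for any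
invariant kernel, `Φ` the exit flux — this file is its extension from indicators to bounded observables,
by the observable's change set instead of the sector's exit set, plus the window bookkeeping and the
typed instances), the reversible `τ_int` floor `Scoring/SectorBottleneckFloor` and the path-space window
`Scoring/SectorFreezingWindow`.  Printed counterparts NAMED ONLY: bottleneck / conductance arguments (Lawler–Sokal 1988;
Sinclair–Jerrum 1989) — nothing is cited as a fact.

## Content (`κ` Markov, `π` a probability law; `|g| ≤ B` measurable; `D = {q | g q.1 ≠ g q.2}`)

* **`integral_mul_sub_kop_le_of_changeProb`** — `∫ g (g − kop κ g) dπ ≤ 2 B² p` if `(π ⊗ₘ κ)(D) ≤ p`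
  (no invariance); `integral_mul_kop_ge_of_changeProb` — `∫ g² dπ − 2B² p ≤ ∫ g · kop κ g dπ`;
* **`changeProb_comp_le`** — `π` invariant: `(π ⊗ₘ (η ∘ₖ κ))(D) ≤ (π ⊗ₘ κ)(D) + (π ⊗ₘ η)(D)`;
  **`changeProb_nHit_le`** — `(π ⊗ₘ nHit κ t)(D) ≤ t · (π ⊗ₘ κ)(D)`;
* **`autocov_ge_of_changeProb`** — `π` invariant, `(π ⊗ₘ κ)(D) ≤ p`: `∫ g² dπ − 2 B² t p ≤ autocov κ π g t`;
* **`tauIntWindow_ge_of_changeProb`** — `Var_π g ≠ 0` (centred `g`):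
  `W + ½ − B² p W (W+1) / Var ≤ tauIntWindow (autocov/Var) W`;
* IN THEORY-2'S TYPED SETTING (`Scaling/TunnellingLaws`: a charge `Q`, a set `S` SEPARATING `Q` along the
  move relation `R`, moves a.s. allowed, `π` invariant — NO reversibility):
  **`changeProb_le_of_separating`** — `(π ⊗ₘ κ){φ(Q x) ≠ φ(Q y)} ≤ 2 π(S)`;
  **`autocov_ge_of_separating`** — `∫ φ(Q)² dπ − 4 B² t π(S) ≤ C_{φ∘Q}(t)` (`|φ ∘ Q| ≤ B`);
  **`tauIntWindow_ge_of_separating`** — `W + ½ − 2 B² π(S) W(W+1)/Var ≤ τ_W(φ ∘ Q)`.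

NOT CLAIMED: a `τ_int` (infinite-window) floor without reversibility (the tail of a non-reversible
autocorrelation can be negative); the value of `p` for any sampler; unbounded observables; any number of
ours.
-/

noncomputable section

namespace Summit.Ventures.LatticeQCDFlow.Scoring

open MeasureTheory ProbabilityTheory Filter Finset Preorder Literature.Probability.MarkovChains
open Summit.Ventures.LatticeQCDFlow.Exactness
open scoped ENNReal Topology

variable {Ω : Type*} [MeasurableSpace Ω]

section ChangeProb

variable (κ : Kernel Ω Ω) [IsMarkovKernel κ] (π : Measure Ω) [IsProbabilityMeasure π]

omit [IsMarkovKernel κ] [IsProbabilityMeasure π] in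
/-- The change set `{(x, y) | g x ≠ g y}` of a measurable real observable is measurable. -/
theorem measurableSet_changeSet {g : Ω → ℝ} (hg : Measurable g) :
    MeasurableSet {q : Ω × Ω | g q.1 ≠ g q.2} := by
  have : {q : Ω × Ω | g q.1 ≠ g q.2} = {q : Ω × Ω | g q.1 = g q.2}ᶜ := by ext q; simp
  rw [this]
  exact (measurableSet_eq_fun (hg.comp measurable_fst) (hg.comp measurable_snd)).compl

/-- **RARE CHANGE `⇒` LAG ONE CLOSE TO THE VARIANCE** (no invariance needed): `|g| ≤ B` measurable,
`(π ⊗ₘ κ){g x ≠ g y} ≤ ENNReal.ofReal p`, `0 ≤ p`; then `∫ g (g − kop κ g) dπ ≤ 2 B² p`. -/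
theorem integral_mul_sub_kop_le_of_changeProb {g : Ω → ℝ} (hg : Measurable g) {B : ℝ}
    (hB : ∀ x, |g x| ≤ B) {p : ℝ} (hp : 0 ≤ p)
    (hchange : (π ⊗ₘ κ) {q : Ω × Ω | g q.1 ≠ g q.2} ≤ ENNReal.ofReal p) :
    ∫ x, g x * (g x - kop κ g x) ∂π ≤ 2 * B ^ 2 * p := by
  have hB0 : 0 ≤ B := (abs_nonneg _).trans (hB (Classical.choice (nonempty_of_isProbabilityMeasure π)))
  -- `g x (g x − K g x) = ∫ g x (g x − g y) dκ(x)`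
  have hinner : ∀ x, g x * (g x - kop κ g x) = ∫ y, g x * (g x - g y) ∂(κ x) := by
    intro x
    unfold kop
    rw [integral_const_mul, integral_sub (integrable_const _) (integrable_of_bounded _ hg hB),
      integral_const, probReal_univ, one_smul]
  have hφm : Measurable fun q : Ω × Ω => g q.1 * (g q.1 - g q.2) :=
    (hg.comp measurable_fst).mul ((hg.comp measurable_fst).sub (hg.comp measurable_snd))
  have hφb : ∀ q : Ω × Ω, |g q.1 * (g q.1 - g q.2)| ≤ B * (B + B) := fun q => by
    rw [abs_mul]
    exact mul_le_mul (hB _) ((abs_sub _ _).trans (add_le_add (hB _) (hB _))) (abs_nonneg _) hB0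
  have hφi : Integrable (fun q : Ω × Ω => g q.1 * (g q.1 - g q.2)) (π ⊗ₘ κ) :=
    integrable_of_bounded _ hφm hφb
  have hfub : ∫ x, g x * (g x - kop κ g x) ∂π = ∫ q, g q.1 * (g q.1 - g q.2) ∂(π ⊗ₘ κ) := by
    rw [Measure.integral_compProd hφi]
    exact integral_congr_ae (ae_of_all _ fun x => hinner x)
  rw [hfub]
  set D : Set (Ω × Ω) := {q | g q.1 ≠ g q.2} with hD
  have hDm : MeasurableSet D := measurableSet_changeSet hg
  have hpt : ∀ q : Ω × Ω, g q.1 * (g q.1 - g q.2) ≤ D.indicator (fun _ => 2 * B ^ 2) q := by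
    intro q
    by_cases hq : q ∈ D
    · rw [Set.indicator_of_mem hq]
      calc g q.1 * (g q.1 - g q.2) ≤ |g q.1 * (g q.1 - g q.2)| := le_abs_self _
        _ ≤ B * (B + B) := hφb q
        _ = 2 * B ^ 2 := by ring
    · have : g q.1 = g q.2 := by simpa [hD] using hq
      rw [Set.indicator_of_notMem hq, this, sub_self, mul_zero]
  have hint : ∫ q, g q.1 * (g q.1 - g q.2) ∂(π ⊗ₘ κ) ≤ 2 * B ^ 2 * ((π ⊗ₘ κ) D).toReal := by
    calc ∫ q, g q.1 * (g q.1 - g q.2) ∂(π ⊗ₘ κ) ≤ ∫ q, D.indicator (fun _ => 2 * B ^ 2) q ∂(π ⊗ₘ κ) :=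
          integral_mono hφi ((integrable_const _).indicator hDm) hpt
      _ = 2 * B ^ 2 * ((π ⊗ₘ κ) D).toReal := by
          rw [integral_indicator hDm, setIntegral_const, smul_eq_mul, mul_comm]; rfl
  have hDp : ((π ⊗ₘ κ) D).toReal ≤ p := ENNReal.toReal_le_of_le_ofReal hp hchange
  nlinarith [hint, hDp, sq_nonneg B]

/-- **`C(1) ≥ ∫ g² dπ − 2B² p`** under the same hypotheses. -/
theorem integral_mul_kop_ge_of_changeProb {g : Ω → ℝ} (hg : Measurable g) {B : ℝ}
    (hB : ∀ x, |g x| ≤ B) {p : ℝ} (hp : 0 ≤ p)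
    (hchange : (π ⊗ₘ κ) {q : Ω × Ω | g q.1 ≠ g q.2} ≤ ENNReal.ofReal p) :
    ∫ x, g x ^ 2 ∂π - 2 * B ^ 2 * p ≤ ∫ x, g x * kop κ g x ∂π := by
  have h := integral_mul_sub_kop_le_of_changeProb κ π hg hB hp hchange
  have hig2 : Integrable (fun x => g x ^ 2) π :=
    integrable_of_bounded π (hg.pow_const 2) (C := B ^ 2) fun y => by
      rw [abs_pow]; exact pow_le_pow_left₀ (abs_nonneg _) (hB y) 2
  have higK : Integrable (fun x => g x * kop κ g x) π :=
    integrable_of_bounded π (hg.mul (measurable_kop κ hg)) (C := |B| * B) fun x => by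
      rw [abs_mul]
      exact mul_le_mul ((hB x).trans (le_abs_self _)) (abs_kop_le κ hB x) (abs_nonneg _) (abs_nonneg _)
  have e : ∫ x, g x * (g x - kop κ g x) ∂π = ∫ x, g x ^ 2 ∂π - ∫ x, g x * kop κ g x ∂π := by
    rw [← integral_sub hig2 higK]
    exact integral_congr_ae (ae_of_all _ fun x => by ring)
  rw [e] at h
  linarith

end ChangeProb

/-! ### The union bound along compositions -/

section Union

variable {κ η : Kernel Ω Ω} [IsMarkovKernel κ] [IsMarkovKernel η] {π : Measure Ω}
  [IsProbabilityMeasure π]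

/-- **UNION BOUND FOR THE CHANGE PROBABILITY OF A COMPOSITION**: `π` `κ`-invariant, `g` measurable,
`D = {g x ≠ g y}`; then `(π ⊗ₘ (η ∘ₖ κ))(D) ≤ (π ⊗ₘ κ)(D) + (π ⊗ₘ η)(D)` (first move by `κ`, then by
`η`; a change overall needs a change in one of the two moves; the intermediate point is `π`-distributed). -/
theorem changeProb_comp_le (hπ : Kernel.Invariant κ π) {g : Ω → ℝ} (hg : Measurable g) :
    (π ⊗ₘ (η ∘ₖ κ)) {q : Ω × Ω | g q.1 ≠ g q.2}
      ≤ (π ⊗ₘ κ) {q : Ω × Ω | g q.1 ≠ g q.2} + (π ⊗ₘ η) {q : Ω × Ω | g q.1 ≠ g q.2} := by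
  set D : Set (Ω × Ω) := {q | g q.1 ≠ g q.2} with hD
  have hDm : MeasurableSet D := measurableSet_changeSet hg
  have hDx : ∀ x, MeasurableSet (Prod.mk x ⁻¹' D) := fun x => measurable_prodMk_left hDm
  -- the three change probabilities as iterated lintegrals
  have h1 : (π ⊗ₘ (η ∘ₖ κ)) D = ∫⁻ x, ∫⁻ y, η y (Prod.mk x ⁻¹' D) ∂(κ x) ∂π := by
    rw [Measure.compProd_apply hDm]
    refine lintegral_congr fun x => ?_
    rw [Kernel.comp_apply' _ _ _ (hDx x)]
  have h2 : (π ⊗ₘ κ) D = ∫⁻ x, κ x (Prod.mk x ⁻¹' D) ∂π := Measure.compProd_apply hDm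
  have h3 : (π ⊗ₘ η) D = ∫⁻ y, η y (Prod.mk y ⁻¹' D) ∂π := Measure.compProd_apply hDm
  -- measurability of `y ↦ η y D_y` and of `y ↦ η y D_x`
  have hmeasD : Measurable fun y => η y (Prod.mk y ⁻¹' D) := Kernel.measurable_kernel_prodMk_left hDm
  -- pointwise union bound: `η y D_x ≤ η y D_y + 1_D (x, y)`
  have hpt : ∀ x y, η y (Prod.mk x ⁻¹' D) ≤ η y (Prod.mk y ⁻¹' D) + D.indicator 1 (x, y) := by
    intro x y
    by_cases hxy : (x, y) ∈ D
    · rw [Set.indicator_of_mem hxy, Pi.one_apply]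
      exact (prob_le_one).trans (by simp)
    · have hgxy : g x = g y := by simpa [hD] using hxy
      have hsets : Prod.mk x ⁻¹' D = Prod.mk y ⁻¹' D := by
        ext z; simp [hD, hgxy]
      rw [hsets, Set.indicator_of_notMem hxy, add_zero]
  -- integrate in `y` against `κ x`, then in `x` against `π`
  have hstep : ∀ x, ∫⁻ y, η y (Prod.mk x ⁻¹' D) ∂(κ x)
      ≤ ∫⁻ y, η y (Prod.mk y ⁻¹' D) ∂(κ x) + κ x (Prod.mk x ⁻¹' D) := by
    intro x
    calc ∫⁻ y, η y (Prod.mk x ⁻¹' D) ∂(κ x)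
        ≤ ∫⁻ y, (η y (Prod.mk y ⁻¹' D) + D.indicator 1 (x, y)) ∂(κ x) := lintegral_mono (hpt x)
      _ = ∫⁻ y, η y (Prod.mk y ⁻¹' D) ∂(κ x) + ∫⁻ y, D.indicator 1 (x, y) ∂(κ x) :=
          lintegral_add_left hmeasD _
      _ = ∫⁻ y, η y (Prod.mk y ⁻¹' D) ∂(κ x) + κ x (Prod.mk x ⁻¹' D) := by
          congr 1
          have : (fun y => D.indicator (1 : Ω × Ω → ℝ≥0∞) (x, y))
              = (Prod.mk x ⁻¹' D).indicator 1 := by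
            funext y; by_cases hy : (x, y) ∈ D <;> simp [Set.indicator, hy]
          rw [this, lintegral_indicator_one (hDx x)]
  rw [h1, h2, h3]
  calc ∫⁻ x, ∫⁻ y, η y (Prod.mk x ⁻¹' D) ∂(κ x) ∂π
      ≤ ∫⁻ x, (∫⁻ y, η y (Prod.mk y ⁻¹' D) ∂(κ x) + κ x (Prod.mk x ⁻¹' D)) ∂π := lintegral_mono hstep
    _ = ∫⁻ x, ∫⁻ y, η y (Prod.mk y ⁻¹' D) ∂(κ x) ∂π + ∫⁻ x, κ x (Prod.mk x ⁻¹' D) ∂π :=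
        lintegral_add_right _ (Kernel.measurable_kernel_prodMk_left hDm)
    _ = ∫⁻ y, η y (Prod.mk y ⁻¹' D) ∂(π.bind κ) + ∫⁻ x, κ x (Prod.mk x ⁻¹' D) ∂π := by
        rw [Measure.lintegral_bind (Kernel.aemeasurable κ) hmeasD.aemeasurable]
    _ = ∫⁻ y, η y (Prod.mk y ⁻¹' D) ∂π + ∫⁻ x, κ x (Prod.mk x ⁻¹' D) ∂π := by rw [hπ.def]
    _ = ∫⁻ x, κ x (Prod.mk x ⁻¹' D) ∂π + ∫⁻ y, η y (Prod.mk y ⁻¹' D) ∂π := add_comm _ _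

/-- **`(π ⊗ₘ κᵗ)(D) ≤ t · (π ⊗ₘ κ)(D)`** for the `t`-step kernel `κᵗ = nHit κ t` (`π` invariant). -/
theorem changeProb_nHit_le (hπ : Kernel.Invariant κ π) {g : Ω → ℝ} (hg : Measurable g) :
    ∀ t : ℕ, (π ⊗ₘ nHit κ t) {q : Ω × Ω | g q.1 ≠ g q.2}
      ≤ (t : ℝ≥0∞) * (π ⊗ₘ κ) {q : Ω × Ω | g q.1 ≠ g q.2}
  | 0 => by
    have hDm : MeasurableSet {q : Ω × Ω | g q.1 ≠ g q.2} := measurableSet_changeSet hg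
    rw [nHit_zero, Measure.compProd_apply hDm]
    have h0 : ∀ a : Ω, (Kernel.id : Kernel Ω Ω) a (Prod.mk a ⁻¹' {q : Ω × Ω | g q.1 ≠ g q.2}) = 0 := by
      intro a
      rw [Kernel.id_apply, Measure.dirac_apply' _ (measurable_prodMk_left hDm), Set.indicator_of_notMem]
      simp
    simp only [h0, lintegral_zero, Nat.cast_zero, zero_mul, le_refl]
  | t + 1 => by
    haveI := isMarkovKernel_nHit κ t
    have ih := changeProb_nHit_le hπ hg t
    have hinv : Kernel.Invariant (nHit κ t) π := invariant_nHit hπ t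
    rw [nHit_succ]
    calc (π ⊗ₘ (κ ∘ₖ nHit κ t)) {q : Ω × Ω | g q.1 ≠ g q.2}
        ≤ (π ⊗ₘ nHit κ t) {q : Ω × Ω | g q.1 ≠ g q.2} + (π ⊗ₘ κ) {q : Ω × Ω | g q.1 ≠ g q.2} :=
          changeProb_comp_le hinv hg
      _ ≤ (t : ℝ≥0∞) * (π ⊗ₘ κ) {q : Ω × Ω | g q.1 ≠ g q.2} + (π ⊗ₘ κ) {q : Ω × Ω | g q.1 ≠ g q.2} :=
          add_le_add ih le_rfl
      _ = ((t + 1 : ℕ) : ℝ≥0∞) * (π ⊗ₘ κ) {q : Ω × Ω | g q.1 ≠ g q.2} := by push_cast; ring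

end Union

/-! ### Every lag, and the windows -/

section Lags

variable {κ : Kernel Ω Ω} [IsMarkovKernel κ] {π : Measure Ω} [IsProbabilityMeasure π]

/-- **`C(t) ≥ ∫ g² dπ − 2 B² t p` AT EVERY LAG** for ANY Markov kernel with `π` invariant:
`|g| ≤ B` measurable, `(π ⊗ₘ κ){g x ≠ g y} ≤ ENNReal.ofReal p`, `0 ≤ p`. -/
theorem autocov_ge_of_changeProb (hπ : Kernel.Invariant κ π) {g : Ω → ℝ} (hg : Measurable g)
    {B : ℝ} (hB : ∀ x, |g x| ≤ B) {p : ℝ} (hp : 0 ≤ p)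
    (hchange : (π ⊗ₘ κ) {q : Ω × Ω | g q.1 ≠ g q.2} ≤ ENNReal.ofReal p) (t : ℕ) :
    ∫ x, g x ^ 2 ∂π - 2 * B ^ 2 * (t * p) ≤ autocov κ π g t := by
  haveI := isMarkovKernel_nHit κ t
  have hct : (π ⊗ₘ nHit κ t) {q : Ω × Ω | g q.1 ≠ g q.2} ≤ ENNReal.ofReal (t * p) := by
    calc (π ⊗ₘ nHit κ t) {q : Ω × Ω | g q.1 ≠ g q.2}
        ≤ (t : ℝ≥0∞) * (π ⊗ₘ κ) {q : Ω × Ω | g q.1 ≠ g q.2} := changeProb_nHit_le hπ hg t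
      _ ≤ (t : ℝ≥0∞) * ENNReal.ofReal p := by gcongr
      _ = ENNReal.ofReal (t * p) := by
          rw [ENNReal.ofReal_mul (Nat.cast_nonneg t), ENNReal.ofReal_natCast]
  have h := integral_mul_kop_ge_of_changeProb (nHit κ t) π hg hB (by positivity) hct
  unfold autocov
  rw [← kop_nHit κ t hg hB]
  exact h

/-- **THE WINDOW FLOOR**: under the same hypotheses with `g` centred-scale `Var = ∫ g² dπ ≠ 0`, every
Γ-method window satisfies `W + ½ − B² p W(W+1)/Var ≤ tauIntWindow (fun t ↦ C(t)/C(0)) W`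
(`Scoring.tauIntWindow ρ W = ½ + Σ_{t<W} ρ(t+1)`, `C(0) = ∫ g² dπ`). -/
theorem tauIntWindow_ge_of_changeProb (hπ : Kernel.Invariant κ π) {g : Ω → ℝ} (hg : Measurable g)
    {B : ℝ} (hB : ∀ x, |g x| ≤ B) {p : ℝ} (hp : 0 ≤ p)
    (hchange : (π ⊗ₘ κ) {q : Ω × Ω | g q.1 ≠ g q.2} ≤ ENNReal.ofReal p)
    (hvar : ∫ x, g x ^ 2 ∂π ≠ 0) (W : ℕ) :
    (W : ℝ) + 1 / 2 - B ^ 2 * p * (W * (W + 1)) / ∫ x, g x ^ 2 ∂π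
      ≤ tauIntWindow (fun t => autocov κ π g t / autocov κ π g 0) W := by
  set V := ∫ x, g x ^ 2 ∂π with hV
  have hVnn : 0 ≤ V := integral_nonneg (μ := π) (f := fun x => g x ^ 2) fun x => sq_nonneg (g x)
  have hV0 : 0 < V := lt_of_le_of_ne hVnn (Ne.symm hvar)
  have e0 : autocov κ π g 0 = V := by rw [autocov_zero]
  unfold tauIntWindow
  simp only [e0]
  -- each normalised lag: `C(t+1)/V ≥ 1 − 2B²(t+1)p/V`
  have hterm : ∀ t ∈ Finset.range W,
      1 - 2 * B ^ 2 * (((t : ℝ) + 1) * p) / V ≤ autocov κ π g (t + 1) / V := by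
    intro t _
    have h := autocov_ge_of_changeProb hπ hg hB hp hchange (t + 1)
    rw [← hV] at h
    push_cast at h
    have h' : (V - 2 * B ^ 2 * (((t : ℝ) + 1) * p)) / V ≤ autocov κ π g (t + 1) / V :=
      div_le_div_of_nonneg_right h hV0.le
    rwa [sub_div, div_self hV0.ne'] at h'
  have hsum := Finset.sum_le_sum hterm
  -- `Σ_{t<W} (1 − 2B²(t+1)p/V) = W − 2B²p/V · W(W+1)/2`
  have hgauss : ∀ n : ℕ, ∑ t ∈ Finset.range n, ((t : ℝ) + 1) = (n : ℝ) * ((n : ℝ) + 1) / 2 := by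
    intro n
    induction n with
    | zero => simp
    | succ n ih => rw [Finset.sum_range_succ, ih]; push_cast; ring
  have hlhs : ∑ t ∈ Finset.range W, (1 - 2 * B ^ 2 * (((t : ℝ) + 1) * p) / V)
      = (W : ℝ) - B ^ 2 * p * (W * (W + 1)) / V := by
    rw [Finset.sum_sub_distrib, Finset.sum_const, Finset.card_range, nsmul_eq_mul, mul_one]
    have : ∑ t ∈ Finset.range W, 2 * B ^ 2 * (((t : ℝ) + 1) * p) / V
        = 2 * B ^ 2 * p / V * ∑ t ∈ Finset.range W, ((t : ℝ) + 1) := by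
      rw [Finset.mul_sum]
      exact Finset.sum_congr rfl fun t _ => by ring
    rw [this, hgauss W]
    ring
  rw [hlhs] at hsum
  linarith

end Lags

/-! ### In theory-2's typed setting: a separating set of small mass freezes every charge observable -/

section Separating

variable {κ : Kernel Ω Ω} [IsMarkovKernel κ] {π : Measure Ω} [IsProbabilityMeasure π]
  {ι : Type*} {R : Ω → Ω → Prop} {Q : Ω → ι} {S : Set Ω} {φ : ι → ℝ}

/-- **THE TUNNELLING LAW FEEDS THE HYPOTHESIS**: if `S` separates the charge `Q` along the move relation
`R` (`Scaling/TunnellingLaws`), the moves of `κ` are a.s. allowed and `π` is invariant, then every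
observable `φ ∘ Q` of the charge changes with stationary one-step probability `≤ 2 π(S)`. -/
theorem changeProb_le_of_separating (hS : ∀ ⦃x y⦄, R x y → Q x ≠ Q y → x ∈ S ∨ y ∈ S)
    (hπ : Kernel.Invariant κ π) (hR : ∀ᵐ q ∂(π ⊗ₘ κ), R q.1 q.2) (φ : ι → ℝ) :
    (π ⊗ₘ κ) {q : Ω × Ω | φ (Q q.1) ≠ φ (Q q.2)} ≤ ENNReal.ofReal (2 * π.real S) := by
  have hsub : {q : Ω × Ω | φ (Q q.1) ≠ φ (Q q.2)} ⊆ {q : Ω × Ω | Q q.1 ≠ Q q.2} := by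
    intro q hq hQ
    exact hq (by rw [hQ])
  calc (π ⊗ₘ κ) {q : Ω × Ω | φ (Q q.1) ≠ φ (Q q.2)}
      ≤ (π ⊗ₘ κ) {q : Ω × Ω | Q q.1 ≠ Q q.2} := measure_mono hsub
    _ ≤ 2 * π S := Theory2.Tunnelling.compProd_chargeChange_le_of_invariant hS π κ hπ hR
    _ = ENNReal.ofReal (2 * π.real S) := by
        rw [ENNReal.ofReal_mul zero_le_two, ENNReal.ofReal_ofNat, ofReal_measureReal]

/-- **FREEZING OF EVERY CHARGE OBSERVABLE, ANY INVARIANT SAMPLER**: under the separating hypothesis,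
`|φ ∘ Q| ≤ B` measurable: `∫ φ(Q)² dπ − 4 B² t π(S) ≤ C_{φ∘Q}(t)` at every lag `t`. -/
theorem autocov_ge_of_separating (hS : ∀ ⦃x y⦄, R x y → Q x ≠ Q y → x ∈ S ∨ y ∈ S)
    (hπ : Kernel.Invariant κ π) (hR : ∀ᵐ q ∂(π ⊗ₘ κ), R q.1 q.2)
    (hg : Measurable fun x => φ (Q x)) {B : ℝ} (hB : ∀ x, |φ (Q x)| ≤ B) (t : ℕ) :
    ∫ x, φ (Q x) ^ 2 ∂π - 4 * B ^ 2 * (t * π.real S) ≤ autocov κ π (fun x => φ (Q x)) t := by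
  have h := autocov_ge_of_changeProb hπ hg hB (by positivity)
    (changeProb_le_of_separating hS hπ hR φ) t
  linarith

/-- **THE WINDOW FLOOR IN THE TYPED SETTING**: with `Var = ∫ φ(Q)² dπ ≠ 0` (centred scale),
`W + ½ − B²(2π(S)) W(W+1)/Var ≤ τ_W(φ ∘ Q)` for every `W`. -/
theorem tauIntWindow_ge_of_separating (hS : ∀ ⦃x y⦄, R x y → Q x ≠ Q y → x ∈ S ∨ y ∈ S)
    (hπ : Kernel.Invariant κ π) (hR : ∀ᵐ q ∂(π ⊗ₘ κ), R q.1 q.2)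
    (hg : Measurable fun x => φ (Q x)) {B : ℝ} (hB : ∀ x, |φ (Q x)| ≤ B)
    (hvar : ∫ x, φ (Q x) ^ 2 ∂π ≠ 0) (W : ℕ) :
    (W : ℝ) + 1 / 2 - B ^ 2 * (2 * π.real S) * (W * (W + 1)) / ∫ x, φ (Q x) ^ 2 ∂π
      ≤ tauIntWindow (fun t => autocov κ π (fun x => φ (Q x)) t
          / autocov κ π (fun x => φ (Q x)) 0) W :=
  tauIntWindow_ge_of_changeProb hπ hg hB (by positivity) (changeProb_le_of_separating hS hπ hR φ)
    hvar W

end Separating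

end Summit.Ventures.LatticeQCDFlow.Scoring

end
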